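import Mathlib
import Summits.Ventures.HodgeRepro.Tier4.Line1.RTFSetting
import Summits.Ventures.HodgeRepro.Tier4.Line1.KernelUnfold

/-!
# Tier4/Line1/L2Dictionary — the `S.inner` ↔ `L²(DG, μ)` dictionary for the J1 glue (rungs (b1)–(b3))

Blind re-derivation cell `pub-hodge-repro`, Tier 4 (README §9–§10), seat t4-L1-p5 (prover, LINE L1, gen 0).
The lead's cut S12599 for the J1 glue `exists_adaptedONB_of_rungs` (t4-L4-p1: the Zorn step on closed invariant
subspaces of `L²(DG)`) rests on a dictionary between the skeleton's integral inner product
`S.inner φ ψ = ∫_{DG} φ · conj ψ` on functions and Mathlib's Hilbert space `Lp ℂ 2 (μ.restrict DG)` — this file is that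
dictionary, extracted from t4-L1-p3's `kernel_spectral` (where it was inline) and completed in both directions:
(b1) `inner_toLp_eq`: `⟪toLp a, toLp b⟫ = S.inner b a`; (b2) `orthonormal_toLp_iff`: the `orth` clause of
`IsAdaptedONB` is exactly `Orthonormal ℂ (toLp ∘ φ)`; (b3) `complete_iff_orthogonal_eq_bot` / `complete_of_dense_span`:
the `complete` clause is exactly `(span (range (toLp ∘ φ)))ᗮ = ⊥`, i.e. density of the span.  Nothing here is about
the spectral wall itself.

Nothing here says anything about the status of the Hodge conjecture for CM abelian varieties, which is NOT proved
(HC_CM is NOT proved by anyone in this repository).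
-/

set_option autoImplicit false

noncomputable section

namespace Summit.Ventures.HodgeRepro.Tier4.Line1.RTF.Setting

open MeasureTheory Topology
open scoped InnerProductSpace

variable {G : Type} [Group G] [TopologicalSpace G] [IsTopologicalGroup G] [MeasurableSpace G]
  [BorelSpace G]

omit [IsTopologicalGroup G] [BorelSpace G]

variable (S : Setting G)

/-- (b1) **The inner product of two `toLp`s is the `L²(DG)` integral**: `⟪toLp a, toLp b⟫ = S.inner b a`
(Mathlib's inner product is conjugate-linear in the FIRST slot, `S.inner` in the second). -/
theorem inner_toLp_eq {a b : G → ℂ} (ha : MemLp a 2 (S.μ.restrict S.DG))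
    (hb : MemLp b 2 (S.μ.restrict S.DG)) :
    ⟪ha.toLp a, hb.toLp b⟫_ℂ = S.inner b a := by
  unfold Setting.inner
  rw [L2.inner_def]
  apply integral_congr_ae
  filter_upwards [ha.coeFn_toLp, hb.coeFn_toLp] with w hwa hwb
  rw [hwa, hwb, RCLike.inner_apply]

/-- (b1′) The inner product of an `L²` class with a `toLp`, read on the representative. -/
theorem inner_Lp_toLp_eq (ψ : Lp ℂ 2 (S.μ.restrict S.DG)) {b : G → ℂ}
    (hb : MemLp b 2 (S.μ.restrict S.DG)) :
    ⟪ψ, hb.toLp b⟫_ℂ = S.inner b (ψ : G → ℂ) := by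
  have h := S.inner_toLp_eq (Lp.memLp ψ) hb
  rwa [Lp.toLp_coeFn] at h

/-- (b1″) The inner product of a `toLp` with an `L²` class, read on the representative. -/
theorem inner_toLp_Lp_eq {a : G → ℂ} (ha : MemLp a 2 (S.μ.restrict S.DG))
    (ψ : Lp ℂ 2 (S.μ.restrict S.DG)) :
    ⟪ha.toLp a, ψ⟫_ℂ = S.inner (ψ : G → ℂ) a := by
  have h := S.inner_toLp_eq ha (Lp.memLp ψ)
  rwa [Lp.toLp_coeFn] at h

/-- (b2) **Orthonormality**: the `orth` clause of `IsAdaptedONB` is exactly `Orthonormal ℂ (toLp ∘ φ)`. -/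
theorem orthonormal_toLp_iff {φ : ℕ → G → ℂ} (hφ : ∀ j, MemLp (φ j) 2 (S.μ.restrict S.DG)) :
    Orthonormal ℂ (fun j => (hφ j).toLp (φ j)) ↔
      ∀ j j', S.inner (φ j) (φ j') = if j = j' then 1 else 0 := by
  rw [orthonormal_iff_ite]
  constructor
  · intro h j j'
    have := h j' j
    rw [S.inner_toLp_eq] at this
    rw [this]
    by_cases hjj : j = j'
    · simp [hjj]
    · simp [hjj, Ne.symm hjj]
  · intro h i j
    rw [S.inner_toLp_eq, h j i]
    by_cases hij : i = j
    · simp [hij]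
    · simp [hij, Ne.symm hij]

/-- (b3) **Completeness**: the `complete` clause of `IsAdaptedONB` is exactly
`(span (range (toLp ∘ φ)))ᗮ = ⊥` in `L²(DG)`. -/
theorem complete_iff_orthogonal_eq_bot {φ : ℕ → G → ℂ}
    (hφ : ∀ j, MemLp (φ j) 2 (S.μ.restrict S.DG)) :
    (∀ ψ : G → ℂ, MemLp ψ 2 (S.μ.restrict S.DG) → (∀ j, S.inner ψ (φ j) = 0) →
        ψ =ᵐ[S.μ.restrict S.DG] 0) ↔
      (Submodule.span ℂ (Set.range fun j => (hφ j).toLp (φ j)))ᗮ = ⊥ := by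
  constructor
  · intro hc
    rw [Submodule.eq_bot_iff]
    intro ψ hψ
    rw [Submodule.mem_orthogonal] at hψ
    have hz : ∀ j, S.inner (ψ : G → ℂ) (φ j) = 0 := fun j => by
      rw [← S.inner_toLp_Lp_eq (hφ j) ψ]
      exact hψ _ (Submodule.subset_span ⟨j, rfl⟩)
    exact Lp.eq_zero_iff_ae_eq_zero.mpr (hc ψ (Lp.memLp ψ) hz)
  · intro hbot ψ hψ hz
    have hmem : hψ.toLp ψ ∈ (Submodule.span ℂ (Set.range fun j => (hφ j).toLp (φ j)))ᗮ := by
      rw [Submodule.mem_orthogonal]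
      intro u hu
      induction hu using Submodule.span_induction with
      | mem x hx =>
        obtain ⟨j, rfl⟩ := hx
        rw [S.inner_toLp_eq]
        exact hz j
      | zero => simp
      | add x y _ _ hx hy => rw [inner_add_left, hx, hy, add_zero]
      | smul c x _ hx => rw [inner_smul_left, hx, mul_zero]
    rw [hbot, Submodule.mem_bot] at hmem
    have := Lp.eq_zero_iff_ae_eq_zero.mp hmem
    exact (hψ.coeFn_toLp.symm.trans this)

/-- (b3′) **Completeness from density**: if the span of the `toLp (φ j)` is dense in `L²(DG)`, the `complete` clause
holds. -/
theorem complete_of_dense_span {φ : ℕ → G → ℂ} (hφ : ∀ j, MemLp (φ j) 2 (S.μ.restrict S.DG))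
    (hdense : (Submodule.span ℂ (Set.range fun j => (hφ j).toLp (φ j))).topologicalClosure = ⊤) :
    ∀ ψ : G → ℂ, MemLp ψ 2 (S.μ.restrict S.DG) → (∀ j, S.inner ψ (φ j) = 0) →
      ψ =ᵐ[S.μ.restrict S.DG] 0 :=
  (S.complete_iff_orthogonal_eq_bot hφ).2 (Submodule.topologicalClosure_eq_top_iff.1 hdense)

/-- (b3″) **Completeness from a Hilbert basis**: if the `toLp (φ j)` ARE a Hilbert basis of `L²(DG)`, the `complete`
clause holds. -/
theorem complete_of_hilbertBasis {φ : ℕ → G → ℂ} (hφ : ∀ j, MemLp (φ j) 2 (S.μ.restrict S.DG))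
    (b : HilbertBasis ℕ ℂ (Lp ℂ 2 (S.μ.restrict S.DG))) (hb : ∀ j, b j = (hφ j).toLp (φ j)) :
    ∀ ψ : G → ℂ, MemLp ψ 2 (S.μ.restrict S.DG) → (∀ j, S.inner ψ (φ j) = 0) →
      ψ =ᵐ[S.μ.restrict S.DG] 0 := by
  apply S.complete_of_dense_span hφ
  have : (Set.range fun j => (hφ j).toLp (φ j)) = Set.range b := by
    ext x
    simp only [Set.mem_range]
    exact ⟨fun ⟨j, hj⟩ => ⟨j, by rw [hb j, hj]⟩, fun ⟨j, hj⟩ => ⟨j, by rw [← hb j, hj]⟩⟩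
  rw [this]
  exact b.dense_span

end Summit.Ventures.HodgeRepro.Tier4.Line1.RTF.Setting

end
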